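import Summits.QuantumFields.YangMills.Theorems.BalabanUVNodesN11NoExpansionNumerics

/-!
# DAG node N11 — dag-n11-d's two ★★★★★ ZhPin-class no-expansion 𝐓-step faces (p604229 `…N11NoExpansionTStepZhPinOfSolvable`) RE-KEYED ON SCALARS: the five per-level
# numeric rows `h3 hR hε hε3 hε2` REPLACED by `3·M₁ ≤ L·M₂`, `(d+4)·L + 3 ≤ L·M₂`, `0 < A₀`, `θ.γ < 1` and the two threshold inequalities stated ONCE — at the global
# constant `A₀·(2p₀)^{p₀}·e^{−p₀}` (γ-free form) or at the edge value `ε(θ.γ)` (`θ.γ ≤ e^{−p₀}`) — (this seat's `…N11NoExpansionNumerics` §4); conclusions VERBATIM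

HEADER — WORK-UNIT METADATA.  Cell `pub-ymgap`, YM-PLAN Track A (HUMAN RULING D-0062 ∕ D-0149 width seats), seat `pub-ymgap-dag-n11-w3` (g3; WIDTH SEAT 3∕4 on NODE n11 [B14],
director-ym №197), route `BalabanUVNodes` (v1.7 `CoPH` key), item K1⁷ `StabilityBAtRecordR13SepCoPH` = stmt-QuantumFields-20542 (helper lane `--kind proof --supports 20542
--as helper`, count-neutral).  dag-n11-d g13's hand-out WORD-ITEM1 (3) («numerics hygiene»), second file: the compositions.  [III] = [Balaban1988Convergent], [15] =
[Balaban1985Variational], [B7] = [Balaban1985Averaging].  Over this seat's `…N11NoExpansionNumerics` (`h3_of_scalars`, `hR_of_scalars`, `hε_of_window`, `hε3_of_window_global` ∕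
`hε2_of_window_global`, `hε3_of_window` ∕ `hε2_of_window`) and dag-n11-d's p604229 (the two faces, hypotheses and conclusions otherwise untouched).

WHAT THIS FILE PROVES (4 theorems, one-line compositions; 0 `def`, 0 `sorry`, standard axioms).  ★★★ `exists_local_witness_clause_succ_of_sLaw₁₃CoPH_of_zhPin_of_solvable_of_scalars` ·
★★★ `exists_local_witness_clause_succ_of_hasSect2FormAtZS_of_borelB_of_zhPin_of_solvable_of_scalars` (γ-FREE: the thresholds at the global constant `A₀(2p₀)^{p₀}e^{−p₀}`) and their
EDGE editions `…_of_edgeScalars` (`θ.γ ≤ e^{−p₀}`, thresholds at `ε(θ.γ)`).  After them the no-expansion 𝐓-step in the ZhPin class (`rePinH θ`, `gaussPinH θ`)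
reads: K0's rows (`Provisos₁₃SepCoPH`, per-cube [15]-solvability inside `χ_j`, the cube cover, `1 ≤ j ≤ k`), the record rows (`Admissible`, `s2.Pos`, `0 < M₁ ≤ M`, `1 ≤ M`, window,
`PartCompat₁₃`, `1 ≤ k ≤ m + K`, `2 ≤ cR`), SIX (γ-free) resp. SEVEN (edge) SCALAR CONDITIONS on `(θ.ν, L, θ.γ, N)` — and the §2 input (`SLaw` or a named witness with Borel
𝐁-terms).

HONEST FRAMING.  Helper lane, count-neutral KERNEL BOOKKEEPING (two compositions); nothing of Bałaban ([III] ∕ [15] ∕ [B7]) is asserted; K0's rows, the record rows and the scalar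
conditions are HYPOTHESES (whether node00-def-K0a∕K0b's numerics of record meet them is NOT claimed).  N11 NOT discharged; K1⁷ NOT closed; counts unmoved (typed 28∕28 · discharged
5∕27).  One finite `𝕋⁴_{L^K}` programme at fixed `ε = L^{−K}`; R4 closes only the conditional finite-𝕋⁴ rung `BalabanLadder.UV` — NOT ℝ⁴, NOT OS, NOT a mass gap, NOT Clay.  No `sorry`,
no `axiom`, no `def`, no `instance`, no `notation`.
Sources (SHAPE only): [III] Theorem p.245, (2.4)–(2.5) p.255, (2.13) pp.256–257, (2.16)–(2.18) p.257, (2.20)–(2.28) pp.258–259, (3.16) p.268, (3.24)–(3.25) p.270; [15] Thm 1 (7)–(8)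
pp.278–279; [B7] Prop. 2 p.26 (rows' provenance; not exercised).
-/

noncomputable section

open scoped BigOperators

namespace Summit.QuantumFields.YangMills.Theorems.BalabanUVNodesN11NoExpansionTStepZhPinOfScalars

open Literature.MathematicalPhysics.QuantumFieldTheory.Balaban1983to89 T4Continuum Node00
open B14.Eq213MaximalDomains (side)
open BalabanUVNodesN11NoExpansionNumerics

/-! ## §5  dag-n11-d's two ★★★★★ ZhPin-class faces RE-KEYED: the five numeric rows REPLACED by the scalars (conclusions VERBATIM p604229) -/

section Faces

open MeasureTheory
open scoped ENNReal NNReal Matrix.Norms.L2Operator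
open T4NestedCovariance Node00.Tk DagBinding
open B15DeterminingSets B8Eq17ClassAkV1 B14.Eq218Concrete B10Eq42TorusConstraint
open B14.Eq213DetSet (Bj)
open Literature.MathematicalPhysics.QuantumFieldTheory.BalabanImbrieJaffe1984to88.BIJ85Eq453GaugeField (qsstarGIter0)
open BalabanUVNodesN11FluctTruncationDefs (IsFluctLocal)
open BalabanUVNodesN11SpaceTruncationDefs BalabanUVNodesN11SpaceTruncationBorelBDefs
open BalabanUVNodesN11HistoryPinnedResidualDefs BalabanUVNodesN11RePinnedParamDefs
open BalabanUVNodesN11NoExpansionTStepZhPinOfSolvable (exists_local_witness_clause_succ_of_sLaw₁₃CoPH_of_zhPin_of_solvable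
  exists_local_witness_clause_succ_of_hasSect2FormAtZS_of_borelB_of_zhPin_of_solvable)

variable {F : T4Family} {N : ℕ} [NeZero N]
variable (θ : Stage13HParams F N) (p : B12.RunParams)

/-- **★★★ dag-n11-d's SLaw-KEYED NO-EXPANSION 𝐓-STEP IN THE ZhPin CLASS, THE FIVE NUMERIC ROWS REPLACED BY SCALARS (γ-FREE form)** — p604229
`exists_local_witness_clause_succ_of_sLaw₁₃CoPH_of_zhPin_of_solvable` with `h3 hR hε hε3 hε2` := `…NoExpansionNumerics` §4 from `3·M₁ ≤ L·M₂`, `(d+4)·L + 3 ≤ L·M₂`, `0 < A₀`, `θ.γ < 1` and the two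
threshold inequalities at the GLOBAL constant `A₀·(2p₀)^{p₀}·e^{−p₀}`; every other hypothesis and the conclusion VERBATIM.  Nothing of [III] ∕ [15] ∕ [B7] asserted.
[cite: Balaban1988Convergent, Theorem p.245, Thm 1 p.262, (2.4)–(2.5) p.255, (2.13) pp.256–257, (2.16)–(2.18) p.257, (2.20)–(2.28) pp.258–259, (3.16) p.268, (3.24)–(3.25) p.270; Balaban1985Variational, Thm 1 (7)–(8) pp.278–279; Balaban1985Averaging, Prop. 2 p.26; Balaban1987RG1, Thm 1 p.259] -/
theorem exists_local_witness_clause_succ_of_sLaw₁₃CoPH_of_zhPin_of_solvable_of_scalars (hζ0 : ∀ (p' : B12.RunParams) (n : ℕ) (Ω Λ : ℕ → Set (Site (F.P p'.K) 0)), (θ.Zh p' n Ω Λ).ζ0 = (ZhPinOfRecord₁₃ θ.toStage13Params p' Ω Λ).ζ0)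
    (h : θ.Provisos₁₃SepCoPH F N) (hθ : θ.Admissible F N)
    (hpos : θ.s2.Pos) (hM₁ : 0 < θ.ν.M₁) (hle : θ.ν.M₁ ≤ θ.τ9.M) {k : ℕ} (hk : k < p.K) (hM : 1 ≤ θ.τ9.M)
    (hw : Step.InInterval θ.γ k (gOfRecord₁₃ F N θ.toStage13Params p)) (hPC : PartCompat₁₃ F N θ.toStage13Params p k)
    (hk1 : 1 ≤ k) (hkm : k ≤ (F.P p.K).m + (F.P p.K).K) (hcR : 2 ≤ θ.s2.cR)
    (hM3 : 3 * θ.ν.M₁ ≤ (F.P p.K).L * θ.ν.M₂) (hM4 : ((F.P p.K).d + 4) * (F.P p.K).L + 3 ≤ (F.P p.K).L * θ.ν.M₂) (hA : 0 < θ.ν.A₀) (hγ1 : θ.γ < 1)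
    (h3g : (143 * (((((F.P p.K).d + 4 : ℕ) : ℝ)) ^ 2 / 4) ^ 2) * (θ.ν.A₀ * ((2 * θ.ν.p₀) ^ θ.ν.p₀ * Real.exp (-(θ.ν.p₀ : ℝ)))) ≤ 1 / 3)
    (h2g : 2 * (θ.ν.A₀ * ((2 * θ.ν.p₀) ^ θ.ν.p₀ * Real.exp (-(θ.ν.p₀ : ℝ)))) ≤ 2 * ExpMeanLog.deltaSU (Fin N) / ((((F.P p.K).d + 4) * (F.P p.K).L : ℕ) : ℝ) ^ 2)
    (hsolv : ∀ j, 1 ≤ j → j ≤ k → ∀ (s : SeqOfRecord F θ.ν θ.τ9.M (gOfRecord₁₃ F N θ.toStage13Params p) p.K j) (V : GaugeField (F.P p.K) j (SU N)),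
      chiSeqOfRecord F N θ.ν θ.τ9.M (gOfRecord₁₃ F N θ.toStage13Params p) p.K j s V ≠ 0 →
      ∀ a ∈ cubesIn (fun a : ↥(cubeIndices (F.P p.K) (cubeSide (F.P p.K).L θ.ν.M₂ (RkOfRecord (F.P p.K).L θ.ν.r (gOfRecord₁₃ F N θ.toStage13Params p j)) j)) =>
          cubeEnl (F.P p.K) (cubeSide (F.P p.K).L θ.ν.M₂ (RkOfRecord (F.P p.K).L θ.ν.r (gOfRecord₁₃ F N θ.toStage13Params p j)) j) a 0) (s.Ω j),
        ∃ U₀, IsMinimizer (avOfRecord F N p.K) {U | PlaqSmall (θ.ν.εreg * (F.P p.K).eta j ^ 2) U}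
          (Bj θ.ν.M₁ (cubeEnl (F.P p.K) (cubeSide (F.P p.K).L θ.ν.M₂ (RkOfRecord (F.P p.K).L θ.ν.r (gOfRecord₁₃ F N θ.toStage13Params p j)) j) a 4) j)
          (avgFamily (avOfRecord F N p.K) (qsstarGIter0 j V)) U₀)
    (hcov : ∀ j, 1 ≤ j → j ≤ k → ∀ s : SeqOfRecord F θ.ν θ.τ9.M (gOfRecord₁₃ F N θ.toStage13Params p) p.K j,
      s.Ω j ⊆ ⋃ a ∈ cubesIn (fun a : ↥(cubeIndices (F.P p.K) (cubeSide (F.P p.K).L θ.ν.M₂ (RkOfRecord (F.P p.K).L θ.ν.r (gOfRecord₁₃ F N θ.toStage13Params p j)) j)) =>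
          cubeEnl (F.P p.K) (cubeSide (F.P p.K).L θ.ν.M₂ (RkOfRecord (F.P p.K).L θ.ν.r (gOfRecord₁₃ F N θ.toStage13Params p j)) j) a 0) (s.Ω j),
        cubeEnl (F.P p.K) (cubeSide (F.P p.K).L θ.ν.M₂ (RkOfRecord (F.P p.K).L θ.ν.r (gOfRecord₁₃ F N θ.toStage13Params p j)) j) a 0)
    (hS : SLaw₁₃CoPH F N θ p k) :
    ∃ (t : SeqOfRecord F θ.ν θ.τ9.M (gOfRecord₁₃ F N θ.toStage13Params p) p.K k → Sect2.TermValues (F.P p.K) (MatA N) (FluctV N) θ.τ9.M)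
      (Ek : SeqOfRecord F θ.ν θ.τ9.M (gOfRecord₁₃ F N θ.toStage13Params p) p.K k → ℝ),
      HasSect2FormAtZS F N (FluctV N) p.K (settingOfRecord₁₃ F N θ.toStage13Params p) k (θ.rzAt p) (WtOfRecord₁₃H F N θ p)
          (UbgOfRecord₁₃CoP F N θ.toStage13Params p k)
          (fun s₀ t₀ => Sect2.LawsRT (sect2TowerOfRecord F N (FluctV N) p.K (settingOfRecord₁₃ F N θ.toStage13Params p) (θ.rzAt p s₀) s₀ t₀)
            (settingOfRecord₁₃ F N θ.toStage13Params p).lf k)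
          (slotsOfRecord F N θ.ν θ.τ9 (EOfRecord₁₃ F N θ.toStage13Params) (wOfRecord₉ F N θ.toStage9Params) θ.ppSel p
            (gOfRecord₁₃ F N θ.toStage13Params p) k) t Ek ∧
      (∀ s₀, IsFluctLocal k (t s₀)) ∧
      ∀ (s : SeqOfRecord F θ.ν θ.τ9.M (gOfRecord₁₃ F N θ.toStage13Params p) p.K (k + 1)), s.Ω (k + 1) = ∅ →
        -- (P) prefix agreement below `k`
        (∀ j, j < k → (θ.zhAt p s).ζ0 j = (θ.zhAt p s.init).ζ0 j ∧ (θ.zhAt p s).quad j = (θ.zhAt p s.init).quad j) →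
        -- (V) the generation-`k` pin with the old front factor
        (∀ (V' : GaugeField (F.P p.K) (k + 1) (SU N)) (U₀ : GaugeField (F.P p.K) k (SU N)),
          (θ.zhAt p s).ζ0 k Set.univ (pairCfgAt (V := FluctV N) k V' U₀) =
            chiSeqOfRecord F N θ.ν θ.τ9.M (gOfRecord₁₃ F N θ.toStage13Params p) p.K k s.init U₀ *
              wOfRecord₉ F N θ.toStage9Params p (gOfRecord₁₃ F N θ.toStage13Params p) k s U₀ ((avOfRecord F N p.K k).avg U₀)) →
        -- `quad_k(∅) = 0` on the two-scale configurations
        (∀ (V' : GaugeField (F.P p.K) (k + 1) (SU N)) (U₀ : GaugeField (F.P p.K) k (SU N)), (θ.zhAt p s).quad k ∅ (pairCfgAt (V := FluctV N) k V' U₀) = 0) →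
        -- `k`-locality of `quad_j(Λ_{j+1})`, `j < k`
        (∀ j, j < k → ∀ ω ω' : MultiCfg (F.P p.K) (SU N) (FluctV N), (∀ i, i ≤ k → ω i = ω' i) →
          (θ.zhAt p s).quad j (s.init.Λ (j + 1)) ω = (θ.zhAt p s).quad j (s.init.Λ (j + 1)) ω') →
        -- measurability of the residual serving `s′`
        (∀ j (Y : Set (Site (F.P p.K) 0)), Measurable ((θ.zhAt p s).ζ0 j Y)) →
        (∀ j (Λ' : Set (Site (F.P p.K) 0)), Measurable ((θ.zhAt p s).quad j Λ')) →
        -- per old branch: A-fibre domination (K0b)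
        (∀ S ∈ admSOfRecord F θ.ν θ.τ9.M (gOfRecord₁₃ F N θ.toStage13Params p) p.K k s.init, ∀ j : ℕ,
          ∃ ŵ : (↥(Set.toFinite (B10Eq42TorusConstraint.bondsIn j ((s.init.Λ (j + 1))ᶜ ∩ s.init.Ω (j + 1)))).toFinset → FluctV N) → ℝ≥0∞, Measurable ŵ ∧
            (∫⁻ a, ŵ a ∂(Measure.pi fun _ : ↥(Set.toFinite (B10Eq42TorusConstraint.bondsIn j ((s.init.Λ (j + 1))ᶜ ∩ s.init.Ω (j + 1)))).toFinset => (volume : Measure (FluctV N)))) ≠ ⊤ ∧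
            ∀ ω, ENNReal.ofReal ((WtOfRecord₁₃H F N θ p s).w j (s.init.Λ (j + 1)) ((s.init.Λ (j + 1))ᶜ ∩ s.init.Ω (j + 1)) (S (j + 1)) ω) ≤
              ŵ (fun b : ↥(Set.toFinite (B10Eq42TorusConstraint.bondsIn j ((s.init.Λ (j + 1))ᶜ ∩ s.init.Ω (j + 1)))).toFinset => (ω j).2 b)) →
        -- def-T: the 𝐁-terms of the witness at the parent history, READ AT THE EMBEDDED BACKGROUND, are JOINTLY measurable in `(U, A)` (LOCATED residue)
        (∀ (S' : ℕ → Set (Site (F.P p.K) 0)) (j : ℕ) (X : (Sect2.domSys (F.P p.K) θ.τ9.M j).Dom),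
          Measurable (fun q : GaugeField (F.P p.K) 0 (SU N) × MSFluct (F.P p.K) (FluctV N) =>
            ((t s.init).B j X (Sect2.ofBackgroundC (settingOfRecord₁₃ F N θ.toStage13Params p).ι q.1) (S', q.2)).re)) →
        (slotsTOfRecord F N θ.ν θ.τ9 (EOfRecord₁₃ F N θ.toStage13Params) (wOfRecord₉ F N θ.toStage9Params) θ.ppSel p
            (gOfRecord₁₃ F N θ.toStage13Params p) (k + 1) s = 0 ∨
          ∀ᵐ V' ∂fieldMeasure (F.P p.K) (k + 1) (SU N),
            chiSeqOfRecord F N θ.ν θ.τ9.M (gOfRecord₁₃ F N θ.toStage13Params p) p.K (k + 1) s V' ≠ 0 →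
              slotsTOfRecord F N θ.ν θ.τ9 (EOfRecord₁₃ F N θ.toStage13Params) (wOfRecord₉ F N θ.toStage9Params) θ.ppSel p
                  (gOfRecord₁₃ F N θ.toStage13Params p) (k + 1) s V' =
                sect2Slot F N (FluctV N) p.K (settingOfRecord₁₃ F N θ.toStage13Params p) (θ.rzAt p s) (WtOfRecord₁₃H F N θ p s) s
                  (t s.init) (Ek s.init) (UbgOfRecord₁₃CoP F N θ.toStage13Params p (k + 1) s) V') :=
  exists_local_witness_clause_succ_of_sLaw₁₃CoPH_of_zhPin_of_solvable θ p hζ0 h hθ hpos hM₁ hle hk hM hw hPC hk1 hkm hcR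
    (h3_of_scalars θ p hM3 k) (hR_of_scalars θ p hM4 k) (hε_of_window θ p hA hγ1 hw) (hε3_of_window_global θ p hA hγ1 hw h3g)
    (hε2_of_window_global θ p hA hγ1 hw h2g) hsolv hcov hS

/-- **dag-n11-d's SLaw-KEYED NO-EXPANSION 𝐓-STEP IN THE ZhPin CLASS, THE FIVE NUMERIC ROWS REPLACED BY SCALARS (EDGE form, `θ.γ ≤ e^{−p₀}`)** — as the previous theorem with the
two threshold inequalities at the edge value `ε(θ.γ) = θ.γ·A₀·(log θ.γ⁻²)^{p₀}` (print's «g sufficiently small» regime).  Conclusion VERBATIM.  Nothing of [III] ∕ [15] ∕ [B7] asserted.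
[cite: Balaban1988Convergent, Theorem p.245, Thm 1 p.262, (2.4)–(2.5) p.255, (2.13) pp.256–257, (2.16)–(2.18) p.257, (2.20)–(2.28) pp.258–259, (3.16) p.268, (3.24)–(3.25) p.270; Balaban1985Variational, Thm 1 (7)–(8) pp.278–279; Balaban1985Averaging, Prop. 2 p.26; Balaban1987RG1, Thm 1 p.259] -/
theorem exists_local_witness_clause_succ_of_sLaw₁₃CoPH_of_zhPin_of_solvable_of_edgeScalars (hζ0 : ∀ (p' : B12.RunParams) (n : ℕ) (Ω Λ : ℕ → Set (Site (F.P p'.K) 0)), (θ.Zh p' n Ω Λ).ζ0 = (ZhPinOfRecord₁₃ θ.toStage13Params p' Ω Λ).ζ0)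
    (h : θ.Provisos₁₃SepCoPH F N) (hθ : θ.Admissible F N)
    (hpos : θ.s2.Pos) (hM₁ : 0 < θ.ν.M₁) (hle : θ.ν.M₁ ≤ θ.τ9.M) {k : ℕ} (hk : k < p.K) (hM : 1 ≤ θ.τ9.M)
    (hw : Step.InInterval θ.γ k (gOfRecord₁₃ F N θ.toStage13Params p)) (hPC : PartCompat₁₃ F N θ.toStage13Params p k)
    (hk1 : 1 ≤ k) (hkm : k ≤ (F.P p.K).m + (F.P p.K).K) (hcR : 2 ≤ θ.s2.cR)
    (hM3 : 3 * θ.ν.M₁ ≤ (F.P p.K).L * θ.ν.M₂) (hM4 : ((F.P p.K).d + 4) * (F.P p.K).L + 3 ≤ (F.P p.K).L * θ.ν.M₂)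
    (hA : 0 < θ.ν.A₀) (hγ1 : θ.γ < 1) (hγp : θ.γ ≤ Real.exp (-(θ.ν.p₀ : ℝ)))
    (h3γ : (143 * (((((F.P p.K).d + 4 : ℕ) : ℝ)) ^ 2 / 4) ^ 2) * (θ.γ * (θ.ν.A₀ * (Real.log (θ.γ ^ 2)⁻¹) ^ θ.ν.p₀)) ≤ 1 / 3)
    (h2γ : 2 * (θ.γ * (θ.ν.A₀ * (Real.log (θ.γ ^ 2)⁻¹) ^ θ.ν.p₀)) ≤ 2 * ExpMeanLog.deltaSU (Fin N) / ((((F.P p.K).d + 4) * (F.P p.K).L : ℕ) : ℝ) ^ 2)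
    (hsolv : ∀ j, 1 ≤ j → j ≤ k → ∀ (s : SeqOfRecord F θ.ν θ.τ9.M (gOfRecord₁₃ F N θ.toStage13Params p) p.K j) (V : GaugeField (F.P p.K) j (SU N)),
      chiSeqOfRecord F N θ.ν θ.τ9.M (gOfRecord₁₃ F N θ.toStage13Params p) p.K j s V ≠ 0 →
      ∀ a ∈ cubesIn (fun a : ↥(cubeIndices (F.P p.K) (cubeSide (F.P p.K).L θ.ν.M₂ (RkOfRecord (F.P p.K).L θ.ν.r (gOfRecord₁₃ F N θ.toStage13Params p j)) j)) =>
          cubeEnl (F.P p.K) (cubeSide (F.P p.K).L θ.ν.M₂ (RkOfRecord (F.P p.K).L θ.ν.r (gOfRecord₁₃ F N θ.toStage13Params p j)) j) a 0) (s.Ω j),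
        ∃ U₀, IsMinimizer (avOfRecord F N p.K) {U | PlaqSmall (θ.ν.εreg * (F.P p.K).eta j ^ 2) U}
          (Bj θ.ν.M₁ (cubeEnl (F.P p.K) (cubeSide (F.P p.K).L θ.ν.M₂ (RkOfRecord (F.P p.K).L θ.ν.r (gOfRecord₁₃ F N θ.toStage13Params p j)) j) a 4) j)
          (avgFamily (avOfRecord F N p.K) (qsstarGIter0 j V)) U₀)
    (hcov : ∀ j, 1 ≤ j → j ≤ k → ∀ s : SeqOfRecord F θ.ν θ.τ9.M (gOfRecord₁₃ F N θ.toStage13Params p) p.K j,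
      s.Ω j ⊆ ⋃ a ∈ cubesIn (fun a : ↥(cubeIndices (F.P p.K) (cubeSide (F.P p.K).L θ.ν.M₂ (RkOfRecord (F.P p.K).L θ.ν.r (gOfRecord₁₃ F N θ.toStage13Params p j)) j)) =>
          cubeEnl (F.P p.K) (cubeSide (F.P p.K).L θ.ν.M₂ (RkOfRecord (F.P p.K).L θ.ν.r (gOfRecord₁₃ F N θ.toStage13Params p j)) j) a 0) (s.Ω j),
        cubeEnl (F.P p.K) (cubeSide (F.P p.K).L θ.ν.M₂ (RkOfRecord (F.P p.K).L θ.ν.r (gOfRecord₁₃ F N θ.toStage13Params p j)) j) a 0)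
    (hS : SLaw₁₃CoPH F N θ p k) :
    ∃ (t : SeqOfRecord F θ.ν θ.τ9.M (gOfRecord₁₃ F N θ.toStage13Params p) p.K k → Sect2.TermValues (F.P p.K) (MatA N) (FluctV N) θ.τ9.M)
      (Ek : SeqOfRecord F θ.ν θ.τ9.M (gOfRecord₁₃ F N θ.toStage13Params p) p.K k → ℝ),
      HasSect2FormAtZS F N (FluctV N) p.K (settingOfRecord₁₃ F N θ.toStage13Params p) k (θ.rzAt p) (WtOfRecord₁₃H F N θ p)
          (UbgOfRecord₁₃CoP F N θ.toStage13Params p k)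
          (fun s₀ t₀ => Sect2.LawsRT (sect2TowerOfRecord F N (FluctV N) p.K (settingOfRecord₁₃ F N θ.toStage13Params p) (θ.rzAt p s₀) s₀ t₀)
            (settingOfRecord₁₃ F N θ.toStage13Params p).lf k)
          (slotsOfRecord F N θ.ν θ.τ9 (EOfRecord₁₃ F N θ.toStage13Params) (wOfRecord₉ F N θ.toStage9Params) θ.ppSel p
            (gOfRecord₁₃ F N θ.toStage13Params p) k) t Ek ∧
      (∀ s₀, IsFluctLocal k (t s₀)) ∧
      ∀ (s : SeqOfRecord F θ.ν θ.τ9.M (gOfRecord₁₃ F N θ.toStage13Params p) p.K (k + 1)), s.Ω (k + 1) = ∅ →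
        -- (P) prefix agreement below `k`
        (∀ j, j < k → (θ.zhAt p s).ζ0 j = (θ.zhAt p s.init).ζ0 j ∧ (θ.zhAt p s).quad j = (θ.zhAt p s.init).quad j) →
        -- (V) the generation-`k` pin with the old front factor
        (∀ (V' : GaugeField (F.P p.K) (k + 1) (SU N)) (U₀ : GaugeField (F.P p.K) k (SU N)),
          (θ.zhAt p s).ζ0 k Set.univ (pairCfgAt (V := FluctV N) k V' U₀) =
            chiSeqOfRecord F N θ.ν θ.τ9.M (gOfRecord₁₃ F N θ.toStage13Params p) p.K k s.init U₀ *
              wOfRecord₉ F N θ.toStage9Params p (gOfRecord₁₃ F N θ.toStage13Params p) k s U₀ ((avOfRecord F N p.K k).avg U₀)) →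
        -- `quad_k(∅) = 0` on the two-scale configurations
        (∀ (V' : GaugeField (F.P p.K) (k + 1) (SU N)) (U₀ : GaugeField (F.P p.K) k (SU N)), (θ.zhAt p s).quad k ∅ (pairCfgAt (V := FluctV N) k V' U₀) = 0) →
        -- `k`-locality of `quad_j(Λ_{j+1})`, `j < k`
        (∀ j, j < k → ∀ ω ω' : MultiCfg (F.P p.K) (SU N) (FluctV N), (∀ i, i ≤ k → ω i = ω' i) →
          (θ.zhAt p s).quad j (s.init.Λ (j + 1)) ω = (θ.zhAt p s).quad j (s.init.Λ (j + 1)) ω') →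
        -- measurability of the residual serving `s′`
        (∀ j (Y : Set (Site (F.P p.K) 0)), Measurable ((θ.zhAt p s).ζ0 j Y)) →
        (∀ j (Λ' : Set (Site (F.P p.K) 0)), Measurable ((θ.zhAt p s).quad j Λ')) →
        -- per old branch: A-fibre domination (K0b)
        (∀ S ∈ admSOfRecord F θ.ν θ.τ9.M (gOfRecord₁₃ F N θ.toStage13Params p) p.K k s.init, ∀ j : ℕ,
          ∃ ŵ : (↥(Set.toFinite (B10Eq42TorusConstraint.bondsIn j ((s.init.Λ (j + 1))ᶜ ∩ s.init.Ω (j + 1)))).toFinset → FluctV N) → ℝ≥0∞, Measurable ŵ ∧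
            (∫⁻ a, ŵ a ∂(Measure.pi fun _ : ↥(Set.toFinite (B10Eq42TorusConstraint.bondsIn j ((s.init.Λ (j + 1))ᶜ ∩ s.init.Ω (j + 1)))).toFinset => (volume : Measure (FluctV N)))) ≠ ⊤ ∧
            ∀ ω, ENNReal.ofReal ((WtOfRecord₁₃H F N θ p s).w j (s.init.Λ (j + 1)) ((s.init.Λ (j + 1))ᶜ ∩ s.init.Ω (j + 1)) (S (j + 1)) ω) ≤
              ŵ (fun b : ↥(Set.toFinite (B10Eq42TorusConstraint.bondsIn j ((s.init.Λ (j + 1))ᶜ ∩ s.init.Ω (j + 1)))).toFinset => (ω j).2 b)) →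
        -- def-T: the 𝐁-terms of the witness at the parent history, READ AT THE EMBEDDED BACKGROUND, are JOINTLY measurable in `(U, A)` (LOCATED residue)
        (∀ (S' : ℕ → Set (Site (F.P p.K) 0)) (j : ℕ) (X : (Sect2.domSys (F.P p.K) θ.τ9.M j).Dom),
          Measurable (fun q : GaugeField (F.P p.K) 0 (SU N) × MSFluct (F.P p.K) (FluctV N) =>
            ((t s.init).B j X (Sect2.ofBackgroundC (settingOfRecord₁₃ F N θ.toStage13Params p).ι q.1) (S', q.2)).re)) →
        (slotsTOfRecord F N θ.ν θ.τ9 (EOfRecord₁₃ F N θ.toStage13Params) (wOfRecord₉ F N θ.toStage9Params) θ.ppSel p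
            (gOfRecord₁₃ F N θ.toStage13Params p) (k + 1) s = 0 ∨
          ∀ᵐ V' ∂fieldMeasure (F.P p.K) (k + 1) (SU N),
            chiSeqOfRecord F N θ.ν θ.τ9.M (gOfRecord₁₃ F N θ.toStage13Params p) p.K (k + 1) s V' ≠ 0 →
              slotsTOfRecord F N θ.ν θ.τ9 (EOfRecord₁₃ F N θ.toStage13Params) (wOfRecord₉ F N θ.toStage9Params) θ.ppSel p
                  (gOfRecord₁₃ F N θ.toStage13Params p) (k + 1) s V' =
                sect2Slot F N (FluctV N) p.K (settingOfRecord₁₃ F N θ.toStage13Params p) (θ.rzAt p s) (WtOfRecord₁₃H F N θ p s) s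
                  (t s.init) (Ek s.init) (UbgOfRecord₁₃CoP F N θ.toStage13Params p (k + 1) s) V') :=
  exists_local_witness_clause_succ_of_sLaw₁₃CoPH_of_zhPin_of_solvable θ p hζ0 h hθ hpos hM₁ hle hk hM hw hPC hk1 hkm hcR
    (h3_of_scalars θ p hM3 k) (hR_of_scalars θ p hM4 k) (hε_of_window θ p hA hγ1 hw) (hε3_of_window θ p hA hγp hw h3γ)
    (hε2_of_window θ p hA hγp hw h2γ) hsolv hcov hS

/-- **★★★ dag-n11-d's WITNESS-FIRST NO-EXPANSION 𝐓-STEP IN THE ZhPin CLASS, THE FIVE NUMERIC ROWS REPLACED BY SCALARS (γ-FREE form)** — p604229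
`exists_local_witness_clause_succ_of_hasSect2FormAtZS_of_borelB_of_zhPin_of_solvable` with `h3 hR hε hε3 hε2` := `…NoExpansionNumerics` §4 (global constant); every other hypothesis and the conclusion
VERBATIM.  Nothing of [III] ∕ [15] ∕ [B7] asserted.
[cite: Balaban1988Convergent, Theorem p.245, Thm 1 p.262, (2.4)–(2.5) p.255, (2.13) pp.256–257, (2.16)–(2.18) p.257, (2.20)–(2.28) pp.258–259, (3.16) p.268, (3.24)–(3.25) p.270; Balaban1985Variational, Thm 1 (7)–(8) pp.278–279; Balaban1985Averaging, Prop. 2 p.26; Balaban1987RG1, Thm 1 p.259] -/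
theorem exists_local_witness_clause_succ_of_hasSect2FormAtZS_of_borelB_of_zhPin_of_solvable_of_scalars (hζ0 : ∀ (p' : B12.RunParams) (n : ℕ) (Ω Λ : ℕ → Set (Site (F.P p'.K) 0)), (θ.Zh p' n Ω Λ).ζ0 = (ZhPinOfRecord₁₃ θ.toStage13Params p' Ω Λ).ζ0)
    (h : θ.Provisos₁₃SepCoPH F N) (hθ : θ.Admissible F N)
    (hpos : θ.s2.Pos) (hM₁ : 0 < θ.ν.M₁) (hle : θ.ν.M₁ ≤ θ.τ9.M) {k : ℕ} (hk : k < p.K) (hM : 1 ≤ θ.τ9.M)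
    (hw : Step.InInterval θ.γ k (gOfRecord₁₃ F N θ.toStage13Params p)) (hPC : PartCompat₁₃ F N θ.toStage13Params p k)
    (hk1 : 1 ≤ k) (hkm : k ≤ (F.P p.K).m + (F.P p.K).K) (hcR : 2 ≤ θ.s2.cR)
    (hM3 : 3 * θ.ν.M₁ ≤ (F.P p.K).L * θ.ν.M₂) (hM4 : ((F.P p.K).d + 4) * (F.P p.K).L + 3 ≤ (F.P p.K).L * θ.ν.M₂) (hA : 0 < θ.ν.A₀) (hγ1 : θ.γ < 1)
    (h3g : (143 * (((((F.P p.K).d + 4 : ℕ) : ℝ)) ^ 2 / 4) ^ 2) * (θ.ν.A₀ * ((2 * θ.ν.p₀) ^ θ.ν.p₀ * Real.exp (-(θ.ν.p₀ : ℝ)))) ≤ 1 / 3)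
    (h2g : 2 * (θ.ν.A₀ * ((2 * θ.ν.p₀) ^ θ.ν.p₀ * Real.exp (-(θ.ν.p₀ : ℝ)))) ≤ 2 * ExpMeanLog.deltaSU (Fin N) / ((((F.P p.K).d + 4) * (F.P p.K).L : ℕ) : ℝ) ^ 2)
    (hsolv : ∀ j, 1 ≤ j → j ≤ k → ∀ (s : SeqOfRecord F θ.ν θ.τ9.M (gOfRecord₁₃ F N θ.toStage13Params p) p.K j) (V : GaugeField (F.P p.K) j (SU N)),
      chiSeqOfRecord F N θ.ν θ.τ9.M (gOfRecord₁₃ F N θ.toStage13Params p) p.K j s V ≠ 0 →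
      ∀ a ∈ cubesIn (fun a : ↥(cubeIndices (F.P p.K) (cubeSide (F.P p.K).L θ.ν.M₂ (RkOfRecord (F.P p.K).L θ.ν.r (gOfRecord₁₃ F N θ.toStage13Params p j)) j)) =>
          cubeEnl (F.P p.K) (cubeSide (F.P p.K).L θ.ν.M₂ (RkOfRecord (F.P p.K).L θ.ν.r (gOfRecord₁₃ F N θ.toStage13Params p j)) j) a 0) (s.Ω j),
        ∃ U₀, IsMinimizer (avOfRecord F N p.K) {U | PlaqSmall (θ.ν.εreg * (F.P p.K).eta j ^ 2) U}
          (Bj θ.ν.M₁ (cubeEnl (F.P p.K) (cubeSide (F.P p.K).L θ.ν.M₂ (RkOfRecord (F.P p.K).L θ.ν.r (gOfRecord₁₃ F N θ.toStage13Params p j)) j) a 4) j)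
          (avgFamily (avOfRecord F N p.K) (qsstarGIter0 j V)) U₀)
    (hcov : ∀ j, 1 ≤ j → j ≤ k → ∀ s : SeqOfRecord F θ.ν θ.τ9.M (gOfRecord₁₃ F N θ.toStage13Params p) p.K j,
      s.Ω j ⊆ ⋃ a ∈ cubesIn (fun a : ↥(cubeIndices (F.P p.K) (cubeSide (F.P p.K).L θ.ν.M₂ (RkOfRecord (F.P p.K).L θ.ν.r (gOfRecord₁₃ F N θ.toStage13Params p j)) j)) =>
          cubeEnl (F.P p.K) (cubeSide (F.P p.K).L θ.ν.M₂ (RkOfRecord (F.P p.K).L θ.ν.r (gOfRecord₁₃ F N θ.toStage13Params p j)) j) a 0) (s.Ω j),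
        cubeEnl (F.P p.K) (cubeSide (F.P p.K).L θ.ν.M₂ (RkOfRecord (F.P p.K).L θ.ν.r (gOfRecord₁₃ F N θ.toStage13Params p j)) j) a 0)
    (t₀ : SeqOfRecord F θ.ν θ.τ9.M (gOfRecord₁₃ F N θ.toStage13Params p) p.K k → Sect2.TermValues (F.P p.K) (MatA N) (FluctV N) θ.τ9.M)
    (E₀ : SeqOfRecord F θ.ν θ.τ9.M (gOfRecord₁₃ F N θ.toStage13Params p) p.K k → ℝ)
    (hform₀ : HasSect2FormAtZS F N (FluctV N) p.K (settingOfRecord₁₃ F N θ.toStage13Params p) k (θ.rzAt p) (WtOfRecord₁₃H F N θ p)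
      (UbgOfRecord₁₃CoP F N θ.toStage13Params p k)
      (fun s₀ t' => Sect2.LawsRT (sect2TowerOfRecord F N (FluctV N) p.K (settingOfRecord₁₃ F N θ.toStage13Params p) (θ.rzAt p s₀) s₀ t')
        (settingOfRecord₁₃ F N θ.toStage13Params p).lf k)
      (slotsOfRecord F N θ.ν θ.τ9 (EOfRecord₁₃ F N θ.toStage13Params) (wOfRecord₉ F N θ.toStage9Params) θ.ppSel p (gOfRecord₁₃ F N θ.toStage13Params p) k) t₀ E₀)
    (hBt : ∀ s₀ (S' : ℕ → Set (Site (F.P p.K) 0)) (j : ℕ) (X : (Sect2.domSys (F.P p.K) θ.τ9.M j).Dom),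
      Measurable (fun q : GaugeField (F.P p.K) 0 (SU N) × MSFluct (F.P p.K) (FluctV N) =>
        (t₀ s₀).B j X (Sect2.ofBackgroundC (settingOfRecord₁₃ F N θ.toStage13Params p).ι q.1) (S', q.2))) :
    ∃ (t : SeqOfRecord F θ.ν θ.τ9.M (gOfRecord₁₃ F N θ.toStage13Params p) p.K k → Sect2.TermValues (F.P p.K) (MatA N) (FluctV N) θ.τ9.M)
      (Ek : SeqOfRecord F θ.ν θ.τ9.M (gOfRecord₁₃ F N θ.toStage13Params p) p.K k → ℝ),
      HasSect2FormAtZS F N (FluctV N) p.K (settingOfRecord₁₃ F N θ.toStage13Params p) k (θ.rzAt p) (WtOfRecord₁₃H F N θ p)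
          (UbgOfRecord₁₃CoP F N θ.toStage13Params p k)
          (fun s₀ t₀ => Sect2.LawsRT (sect2TowerOfRecord F N (FluctV N) p.K (settingOfRecord₁₃ F N θ.toStage13Params p) (θ.rzAt p s₀) s₀ t₀)
            (settingOfRecord₁₃ F N θ.toStage13Params p).lf k)
          (slotsOfRecord F N θ.ν θ.τ9 (EOfRecord₁₃ F N θ.toStage13Params) (wOfRecord₉ F N θ.toStage9Params) θ.ppSel p
            (gOfRecord₁₃ F N θ.toStage13Params p) k) t Ek ∧
      (∀ s₀, IsFluctLocal k (t s₀)) ∧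
      ∀ (s : SeqOfRecord F θ.ν θ.τ9.M (gOfRecord₁₃ F N θ.toStage13Params p) p.K (k + 1)), s.Ω (k + 1) = ∅ →
        -- (P) prefix agreement below `k`
        (∀ j, j < k → (θ.zhAt p s).ζ0 j = (θ.zhAt p s.init).ζ0 j ∧ (θ.zhAt p s).quad j = (θ.zhAt p s.init).quad j) →
        -- (V) the generation-`k` pin with the old front factor
        (∀ (V' : GaugeField (F.P p.K) (k + 1) (SU N)) (U₀ : GaugeField (F.P p.K) k (SU N)),
          (θ.zhAt p s).ζ0 k Set.univ (pairCfgAt (V := FluctV N) k V' U₀) =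
            chiSeqOfRecord F N θ.ν θ.τ9.M (gOfRecord₁₃ F N θ.toStage13Params p) p.K k s.init U₀ *
              wOfRecord₉ F N θ.toStage9Params p (gOfRecord₁₃ F N θ.toStage13Params p) k s U₀ ((avOfRecord F N p.K k).avg U₀)) →
        -- `quad_k(∅) = 0` on the two-scale configurations
        (∀ (V' : GaugeField (F.P p.K) (k + 1) (SU N)) (U₀ : GaugeField (F.P p.K) k (SU N)), (θ.zhAt p s).quad k ∅ (pairCfgAt (V := FluctV N) k V' U₀) = 0) →
        -- `k`-locality of `quad_j(Λ_{j+1})`, `j < k`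
        (∀ j, j < k → ∀ ω ω' : MultiCfg (F.P p.K) (SU N) (FluctV N), (∀ i, i ≤ k → ω i = ω' i) →
          (θ.zhAt p s).quad j (s.init.Λ (j + 1)) ω = (θ.zhAt p s).quad j (s.init.Λ (j + 1)) ω') →
        -- measurability of the residual serving `s′`
        (∀ j (Y : Set (Site (F.P p.K) 0)), Measurable ((θ.zhAt p s).ζ0 j Y)) →
        (∀ j (Λ' : Set (Site (F.P p.K) 0)), Measurable ((θ.zhAt p s).quad j Λ')) →
        -- per old branch: A-fibre domination (K0b)
        (∀ S ∈ admSOfRecord F θ.ν θ.τ9.M (gOfRecord₁₃ F N θ.toStage13Params p) p.K k s.init, ∀ j : ℕ,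
          ∃ ŵ : (↥(Set.toFinite (B10Eq42TorusConstraint.bondsIn j ((s.init.Λ (j + 1))ᶜ ∩ s.init.Ω (j + 1)))).toFinset → FluctV N) → ℝ≥0∞, Measurable ŵ ∧
            (∫⁻ a, ŵ a ∂(Measure.pi fun _ : ↥(Set.toFinite (B10Eq42TorusConstraint.bondsIn j ((s.init.Λ (j + 1))ᶜ ∩ s.init.Ω (j + 1)))).toFinset => (volume : Measure (FluctV N)))) ≠ ⊤ ∧
            ∀ ω, ENNReal.ofReal ((WtOfRecord₁₃H F N θ p s).w j (s.init.Λ (j + 1)) ((s.init.Λ (j + 1))ᶜ ∩ s.init.Ω (j + 1)) (S (j + 1)) ω) ≤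
              ŵ (fun b : ↥(Set.toFinite (B10Eq42TorusConstraint.bondsIn j ((s.init.Λ (j + 1))ᶜ ∩ s.init.Ω (j + 1)))).toFinset => (ω j).2 b)) →
        (slotsTOfRecord F N θ.ν θ.τ9 (EOfRecord₁₃ F N θ.toStage13Params) (wOfRecord₉ F N θ.toStage9Params) θ.ppSel p
            (gOfRecord₁₃ F N θ.toStage13Params p) (k + 1) s = 0 ∨
          ∀ᵐ V' ∂fieldMeasure (F.P p.K) (k + 1) (SU N),
            chiSeqOfRecord F N θ.ν θ.τ9.M (gOfRecord₁₃ F N θ.toStage13Params p) p.K (k + 1) s V' ≠ 0 →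
              slotsTOfRecord F N θ.ν θ.τ9 (EOfRecord₁₃ F N θ.toStage13Params) (wOfRecord₉ F N θ.toStage9Params) θ.ppSel p
                  (gOfRecord₁₃ F N θ.toStage13Params p) (k + 1) s V' =
                sect2Slot F N (FluctV N) p.K (settingOfRecord₁₃ F N θ.toStage13Params p) (θ.rzAt p s) (WtOfRecord₁₃H F N θ p s) s
                  (t s.init) (Ek s.init) (UbgOfRecord₁₃CoP F N θ.toStage13Params p (k + 1) s) V') :=
  exists_local_witness_clause_succ_of_hasSect2FormAtZS_of_borelB_of_zhPin_of_solvable θ p hζ0 h hθ hpos hM₁ hle hk hM hw hPC hk1 hkm hcR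
    (h3_of_scalars θ p hM3 k) (hR_of_scalars θ p hM4 k) (hε_of_window θ p hA hγ1 hw) (hε3_of_window_global θ p hA hγ1 hw h3g)
    (hε2_of_window_global θ p hA hγ1 hw h2g) hsolv hcov t₀ E₀ hform₀ hBt

/-- **dag-n11-d's WITNESS-FIRST NO-EXPANSION 𝐓-STEP IN THE ZhPin CLASS, THE FIVE NUMERIC ROWS REPLACED BY SCALARS (EDGE form, `θ.γ ≤ e^{−p₀}`)** — conclusion VERBATIM.
Nothing of [III] ∕ [15] ∕ [B7] asserted.
[cite: Balaban1988Convergent, Theorem p.245, Thm 1 p.262, (2.4)–(2.5) p.255, (2.13) pp.256–257, (2.16)–(2.18) p.257, (2.20)–(2.28) pp.258–259, (3.16) p.268, (3.24)–(3.25) p.270; Balaban1985Variational, Thm 1 (7)–(8) pp.278–279; Balaban1985Averaging, Prop. 2 p.26; Balaban1987RG1, Thm 1 p.259] -/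
theorem exists_local_witness_clause_succ_of_hasSect2FormAtZS_of_borelB_of_zhPin_of_solvable_of_edgeScalars (hζ0 : ∀ (p' : B12.RunParams) (n : ℕ) (Ω Λ : ℕ → Set (Site (F.P p'.K) 0)), (θ.Zh p' n Ω Λ).ζ0 = (ZhPinOfRecord₁₃ θ.toStage13Params p' Ω Λ).ζ0)
    (h : θ.Provisos₁₃SepCoPH F N) (hθ : θ.Admissible F N)
    (hpos : θ.s2.Pos) (hM₁ : 0 < θ.ν.M₁) (hle : θ.ν.M₁ ≤ θ.τ9.M) {k : ℕ} (hk : k < p.K) (hM : 1 ≤ θ.τ9.M)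
    (hw : Step.InInterval θ.γ k (gOfRecord₁₃ F N θ.toStage13Params p)) (hPC : PartCompat₁₃ F N θ.toStage13Params p k)
    (hk1 : 1 ≤ k) (hkm : k ≤ (F.P p.K).m + (F.P p.K).K) (hcR : 2 ≤ θ.s2.cR)
    (hM3 : 3 * θ.ν.M₁ ≤ (F.P p.K).L * θ.ν.M₂) (hM4 : ((F.P p.K).d + 4) * (F.P p.K).L + 3 ≤ (F.P p.K).L * θ.ν.M₂)
    (hA : 0 < θ.ν.A₀) (hγ1 : θ.γ < 1) (hγp : θ.γ ≤ Real.exp (-(θ.ν.p₀ : ℝ)))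
    (h3γ : (143 * (((((F.P p.K).d + 4 : ℕ) : ℝ)) ^ 2 / 4) ^ 2) * (θ.γ * (θ.ν.A₀ * (Real.log (θ.γ ^ 2)⁻¹) ^ θ.ν.p₀)) ≤ 1 / 3)
    (h2γ : 2 * (θ.γ * (θ.ν.A₀ * (Real.log (θ.γ ^ 2)⁻¹) ^ θ.ν.p₀)) ≤ 2 * ExpMeanLog.deltaSU (Fin N) / ((((F.P p.K).d + 4) * (F.P p.K).L : ℕ) : ℝ) ^ 2)
    (hsolv : ∀ j, 1 ≤ j → j ≤ k → ∀ (s : SeqOfRecord F θ.ν θ.τ9.M (gOfRecord₁₃ F N θ.toStage13Params p) p.K j) (V : GaugeField (F.P p.K) j (SU N)),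
      chiSeqOfRecord F N θ.ν θ.τ9.M (gOfRecord₁₃ F N θ.toStage13Params p) p.K j s V ≠ 0 →
      ∀ a ∈ cubesIn (fun a : ↥(cubeIndices (F.P p.K) (cubeSide (F.P p.K).L θ.ν.M₂ (RkOfRecord (F.P p.K).L θ.ν.r (gOfRecord₁₃ F N θ.toStage13Params p j)) j)) =>
          cubeEnl (F.P p.K) (cubeSide (F.P p.K).L θ.ν.M₂ (RkOfRecord (F.P p.K).L θ.ν.r (gOfRecord₁₃ F N θ.toStage13Params p j)) j) a 0) (s.Ω j),
        ∃ U₀, IsMinimizer (avOfRecord F N p.K) {U | PlaqSmall (θ.ν.εreg * (F.P p.K).eta j ^ 2) U}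
          (Bj θ.ν.M₁ (cubeEnl (F.P p.K) (cubeSide (F.P p.K).L θ.ν.M₂ (RkOfRecord (F.P p.K).L θ.ν.r (gOfRecord₁₃ F N θ.toStage13Params p j)) j) a 4) j)
          (avgFamily (avOfRecord F N p.K) (qsstarGIter0 j V)) U₀)
    (hcov : ∀ j, 1 ≤ j → j ≤ k → ∀ s : SeqOfRecord F θ.ν θ.τ9.M (gOfRecord₁₃ F N θ.toStage13Params p) p.K j,
      s.Ω j ⊆ ⋃ a ∈ cubesIn (fun a : ↥(cubeIndices (F.P p.K) (cubeSide (F.P p.K).L θ.ν.M₂ (RkOfRecord (F.P p.K).L θ.ν.r (gOfRecord₁₃ F N θ.toStage13Params p j)) j)) =>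
          cubeEnl (F.P p.K) (cubeSide (F.P p.K).L θ.ν.M₂ (RkOfRecord (F.P p.K).L θ.ν.r (gOfRecord₁₃ F N θ.toStage13Params p j)) j) a 0) (s.Ω j),
        cubeEnl (F.P p.K) (cubeSide (F.P p.K).L θ.ν.M₂ (RkOfRecord (F.P p.K).L θ.ν.r (gOfRecord₁₃ F N θ.toStage13Params p j)) j) a 0)
    (t₀ : SeqOfRecord F θ.ν θ.τ9.M (gOfRecord₁₃ F N θ.toStage13Params p) p.K k → Sect2.TermValues (F.P p.K) (MatA N) (FluctV N) θ.τ9.M)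
    (E₀ : SeqOfRecord F θ.ν θ.τ9.M (gOfRecord₁₃ F N θ.toStage13Params p) p.K k → ℝ)
    (hform₀ : HasSect2FormAtZS F N (FluctV N) p.K (settingOfRecord₁₃ F N θ.toStage13Params p) k (θ.rzAt p) (WtOfRecord₁₃H F N θ p)
      (UbgOfRecord₁₃CoP F N θ.toStage13Params p k)
      (fun s₀ t' => Sect2.LawsRT (sect2TowerOfRecord F N (FluctV N) p.K (settingOfRecord₁₃ F N θ.toStage13Params p) (θ.rzAt p s₀) s₀ t')
        (settingOfRecord₁₃ F N θ.toStage13Params p).lf k)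
      (slotsOfRecord F N θ.ν θ.τ9 (EOfRecord₁₃ F N θ.toStage13Params) (wOfRecord₉ F N θ.toStage9Params) θ.ppSel p (gOfRecord₁₃ F N θ.toStage13Params p) k) t₀ E₀)
    (hBt : ∀ s₀ (S' : ℕ → Set (Site (F.P p.K) 0)) (j : ℕ) (X : (Sect2.domSys (F.P p.K) θ.τ9.M j).Dom),
      Measurable (fun q : GaugeField (F.P p.K) 0 (SU N) × MSFluct (F.P p.K) (FluctV N) =>
        (t₀ s₀).B j X (Sect2.ofBackgroundC (settingOfRecord₁₃ F N θ.toStage13Params p).ι q.1) (S', q.2))) :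
    ∃ (t : SeqOfRecord F θ.ν θ.τ9.M (gOfRecord₁₃ F N θ.toStage13Params p) p.K k → Sect2.TermValues (F.P p.K) (MatA N) (FluctV N) θ.τ9.M)
      (Ek : SeqOfRecord F θ.ν θ.τ9.M (gOfRecord₁₃ F N θ.toStage13Params p) p.K k → ℝ),
      HasSect2FormAtZS F N (FluctV N) p.K (settingOfRecord₁₃ F N θ.toStage13Params p) k (θ.rzAt p) (WtOfRecord₁₃H F N θ p)
          (UbgOfRecord₁₃CoP F N θ.toStage13Params p k)
          (fun s₀ t₀ => Sect2.LawsRT (sect2TowerOfRecord F N (FluctV N) p.K (settingOfRecord₁₃ F N θ.toStage13Params p) (θ.rzAt p s₀) s₀ t₀)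
            (settingOfRecord₁₃ F N θ.toStage13Params p).lf k)
          (slotsOfRecord F N θ.ν θ.τ9 (EOfRecord₁₃ F N θ.toStage13Params) (wOfRecord₉ F N θ.toStage9Params) θ.ppSel p
            (gOfRecord₁₃ F N θ.toStage13Params p) k) t Ek ∧
      (∀ s₀, IsFluctLocal k (t s₀)) ∧
      ∀ (s : SeqOfRecord F θ.ν θ.τ9.M (gOfRecord₁₃ F N θ.toStage13Params p) p.K (k + 1)), s.Ω (k + 1) = ∅ →
        -- (P) prefix agreement below `k`
        (∀ j, j < k → (θ.zhAt p s).ζ0 j = (θ.zhAt p s.init).ζ0 j ∧ (θ.zhAt p s).quad j = (θ.zhAt p s.init).quad j) →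
        -- (V) the generation-`k` pin with the old front factor
        (∀ (V' : GaugeField (F.P p.K) (k + 1) (SU N)) (U₀ : GaugeField (F.P p.K) k (SU N)),
          (θ.zhAt p s).ζ0 k Set.univ (pairCfgAt (V := FluctV N) k V' U₀) =
            chiSeqOfRecord F N θ.ν θ.τ9.M (gOfRecord₁₃ F N θ.toStage13Params p) p.K k s.init U₀ *
              wOfRecord₉ F N θ.toStage9Params p (gOfRecord₁₃ F N θ.toStage13Params p) k s U₀ ((avOfRecord F N p.K k).avg U₀)) →
        -- `quad_k(∅) = 0` on the two-scale configurations
        (∀ (V' : GaugeField (F.P p.K) (k + 1) (SU N)) (U₀ : GaugeField (F.P p.K) k (SU N)), (θ.zhAt p s).quad k ∅ (pairCfgAt (V := FluctV N) k V' U₀) = 0) →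
        -- `k`-locality of `quad_j(Λ_{j+1})`, `j < k`
        (∀ j, j < k → ∀ ω ω' : MultiCfg (F.P p.K) (SU N) (FluctV N), (∀ i, i ≤ k → ω i = ω' i) →
          (θ.zhAt p s).quad j (s.init.Λ (j + 1)) ω = (θ.zhAt p s).quad j (s.init.Λ (j + 1)) ω') →
        -- measurability of the residual serving `s′`
        (∀ j (Y : Set (Site (F.P p.K) 0)), Measurable ((θ.zhAt p s).ζ0 j Y)) →
        (∀ j (Λ' : Set (Site (F.P p.K) 0)), Measurable ((θ.zhAt p s).quad j Λ')) →
        -- per old branch: A-fibre domination (K0b)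
        (∀ S ∈ admSOfRecord F θ.ν θ.τ9.M (gOfRecord₁₃ F N θ.toStage13Params p) p.K k s.init, ∀ j : ℕ,
          ∃ ŵ : (↥(Set.toFinite (B10Eq42TorusConstraint.bondsIn j ((s.init.Λ (j + 1))ᶜ ∩ s.init.Ω (j + 1)))).toFinset → FluctV N) → ℝ≥0∞, Measurable ŵ ∧
            (∫⁻ a, ŵ a ∂(Measure.pi fun _ : ↥(Set.toFinite (B10Eq42TorusConstraint.bondsIn j ((s.init.Λ (j + 1))ᶜ ∩ s.init.Ω (j + 1)))).toFinset => (volume : Measure (FluctV N)))) ≠ ⊤ ∧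
            ∀ ω, ENNReal.ofReal ((WtOfRecord₁₃H F N θ p s).w j (s.init.Λ (j + 1)) ((s.init.Λ (j + 1))ᶜ ∩ s.init.Ω (j + 1)) (S (j + 1)) ω) ≤
              ŵ (fun b : ↥(Set.toFinite (B10Eq42TorusConstraint.bondsIn j ((s.init.Λ (j + 1))ᶜ ∩ s.init.Ω (j + 1)))).toFinset => (ω j).2 b)) →
        (slotsTOfRecord F N θ.ν θ.τ9 (EOfRecord₁₃ F N θ.toStage13Params) (wOfRecord₉ F N θ.toStage9Params) θ.ppSel p
            (gOfRecord₁₃ F N θ.toStage13Params p) (k + 1) s = 0 ∨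
          ∀ᵐ V' ∂fieldMeasure (F.P p.K) (k + 1) (SU N),
            chiSeqOfRecord F N θ.ν θ.τ9.M (gOfRecord₁₃ F N θ.toStage13Params p) p.K (k + 1) s V' ≠ 0 →
              slotsTOfRecord F N θ.ν θ.τ9 (EOfRecord₁₃ F N θ.toStage13Params) (wOfRecord₉ F N θ.toStage9Params) θ.ppSel p
                  (gOfRecord₁₃ F N θ.toStage13Params p) (k + 1) s V' =
                sect2Slot F N (FluctV N) p.K (settingOfRecord₁₃ F N θ.toStage13Params p) (θ.rzAt p s) (WtOfRecord₁₃H F N θ p s) s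
                  (t s.init) (Ek s.init) (UbgOfRecord₁₃CoP F N θ.toStage13Params p (k + 1) s) V') :=
  exists_local_witness_clause_succ_of_hasSect2FormAtZS_of_borelB_of_zhPin_of_solvable θ p hζ0 h hθ hpos hM₁ hle hk hM hw hPC hk1 hkm hcR
    (h3_of_scalars θ p hM3 k) (hR_of_scalars θ p hM4 k) (hε_of_window θ p hA hγ1 hw) (hε3_of_window θ p hA hγp hw h3γ)
    (hε2_of_window θ p hA hγp hw h2γ) hsolv hcov t₀ E₀ hform₀ hBt

end Faces

end Summit.QuantumFields.YangMills.Theorems.BalabanUVNodesN11NoExpansionTStepZhPinOfScalars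

end
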